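import Summits.CriticalPhenomena.PercolationContinuityZ3.Theorems.PercNearOneGluingNoHeavyLowerTailSahiSymCubeCheck
import Summits.CriticalPhenomena.PercolationContinuityZ3.Theorems.PercNearOneGluingNoHeavyLowerTailSahiSymCubeMemo

/-!
# Sahi's `C_9` on the cube `{0,1}^5` by the symmetry-reduced coloured-antichain check (memoised leaf test): COMPUTATIONAL chunk B

Support file (cell `prim-sahi`, seat `prim-sahi-typer` gen 29; `--supports stmt-CriticalPhenomena-4575`, computational).  One `native_decide`
evaluation of a range of …`SahiSymCubeCheck`'s `symCheckT 5 9 (testM 5 9 65)` (canonical antichains `31, …, 155` of `canonE 5`; 1 order-`9`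
digit test with the memoised Lieb–Sahi recursion …`SahiSymCubeMemo.testM`, base `2^65`).  Assembled in …`SahiSymCubeFiveNine`. [this work]
-/

namespace Summit.CriticalPhenomena.PercolationContinuityZ3.Theorems.SahiSymCube

/-- Chunk B of the order-`9` check on `{0,1}^5`: canonical antichains `31, …, 155` (1 digit test). [this work, computational] -/
theorem symCheck_five_9_chunkB : symCheckRange 5 9 (testM 5 9 65) 31 125 = true := by
  native_decide

end Summit.CriticalPhenomena.PercolationContinuityZ3.Theorems.SahiSymCube
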